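import Summits.BirchSwinnertonDyer.Rank1Residual.Iwasawa.RankGrowthLayer
import Literature.NumberTheory.EllipticCurves.Greenberg1999.MordellWeilRankLayerBoundProofs
import Summits.BirchSwinnertonDyer.Rank1Residual.Additive.CongruentPartnerMainConjectureX3GordBSD
import Summits.BirchSwinnertonDyer.Rank1Residual.AdditivePotMult.PotMultX3BudgetRankZeroEnds
import HarnessLib

/-!
# The Route-G budget `BudgetLeLambdaAt p W b` from a RANK-GROWTH certificate in the cyclotomic tower
# ("ARM ρ": `b ≤ rank_ℤ E(ℚ_k) ⟹ b ≤ λ(X(E/ℚ_∞))`, Greenberg 1999 Thm. 1.9 — a tree THEOREM), and the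
# rank-`0` ENDS of the four N10/N11 loci with the budget so supplied (cell `b2b-bsdres`, team n1011,
# seat p12 (gen 4); row T-E3g-RG, idle-rule claim 2026-08-21T11:0xZ; serves ROUTE-2 II.15.2's residue)

HONEST FRAMING (cell `b2b-bsdres`, run/shared/lean/b2b/bsd-rank1-residual/, verbatim in every
file): the goal of the cell is to DELETE the COMBINATION-SHAPED residual classes of the
Birch–Swinnerton-Dyer formula for ALL analytic-rank `≤ 1` elliptic curves over `ℚ` — "full BSD
formula for every rank `≤ 1` curve in class `C`" assembled STRICTLY from published theorems — so
that the rank-`≤ 1` remainder becomes exactly the CONSTRUCTION-SHAPED classes, which are TYPED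
(missing-input `Prop`s), NOT attempted. This is not "finishing BSD". Team n1011 (N10/N11: X4 ∧
`p = 3`; X3♯): research routes on CONSTRUCTION-SHAPED classes; prove what is provable now; no claim
beyond stated classes; census output = EVIDENCE / conjecture items, never a Literature fact;
RESIDUAL-MAP marks UNCHANGED; nothing is booked by this file. THEOREMS ONLY: no definition, no named
fact, no conjecture node; every cited input is an EXISTING tree declaration consumed BY NAME.

## What and why

Route G (p10 `Additive/CongruentPartnerMainConjecture*.lean`, p07 (M), p06 X3♯(G-ord), p12 X3♯(M))
closes the tame-branch main conjecture at a certified pair from the Kato / Wuthrich half + ONE unit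
coefficient at index `b` + ONE typed LOWER input `BudgetLeLambdaAt p W b` ("`μ(X) = 0 ⟹ b ≤ λ(X(E/ℚ_∞))`").
Discharges of the budget in the tree so far: (0) `b ≤ rank E(ℚ)`
(`AdditivePotMult.budgetLeLambdaAt_of_le_mordellWeilRank`, a theorem); (α) a module-congruent partner
(`budgetLeLambdaAt_of_congruentLambdaShift`, typed transfer); (G) the Greenberg-1999 Prop. 4.14 record +
ONE residual count `ResidualSelmerRankGeAt p W b` (cc-typer-2's schema with p12's (L1)/(L2) theorems,
`budgetLeLambdaAt_of_prop414_of_residualSurj''`; flag `X3-budget-unprinted` on reducible rows; referee 1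
R12.1 / lead R5-44 (g): the Prop-4.14 record is not instantiated on O5/O6 (potentially supersingular)
rows — no `Λ`-cotorsion input there); (0⁺) the same count from LEVEL-0 rational classes (p10 GEN 4,
row T-E3g-BUD0, in progress; Greenberg LNM 1716 Cor. 5.6's proof, r2 II.17).

THIS FILE adds the RANK-GROWTH discharge, which needs NONE of: Prop. 4.14, `p ∤ #E(ℚ)_tors`, a
residual count, `μ = 0`, an image hypothesis, a reduction hypothesis at `p`. Greenberg, LNM 1716, Thm.
1.9 ("the rank of the Mordell–Weil group `E(F_n)` is bounded above by `λ_E`") is a THEOREM of the tree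
for EVERY `ℤ_p`-extension of every number field and every reduction type
(`WeierstrassCurve.mordellWeilRank_layer_le_lambdaInvariant`, unit additive-p3,
`Literature/…/Greenberg1999/MordellWeilRankLayerBoundProofs.lean`), and the cell already has the typed
certificate shape `Iwasawa.LayerRankGEAt W p k m` ("`m ≤ rank_ℤ E(ℚ_k)`", `ℚ_k = κ.layer k`,
`ℚ_1 = ℚ(ζ_{p²})⁺`; unit additive-p3 / instrument seat iw-1, `Iwasawa/RankGrowthLayer.lean`) with
consumers on X1 / X2 / X11b (`lamAlgGEAt_of_layerRankGEAt`, `algebraicLambdaGE_of_layerRankGEAt`) —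
but NO consumer in n1011's budget currency (`lean search budgetLeLambdaAt_of_` 2026-08-21T10:58Z: none).
Hence:

* §1 **`budgetLeLambdaAt_of_layerRankGEAt : Iwasawa.LayerRankGEAt W p k b → BudgetLeLambdaAt p W b`**
  (every `k`; the `μ = 0` binder of the budget is idle), `…_of_le` (`b ≤ m`), and the layer-`0` reading
  `budgetLeLambdaAt_of_le_mordellWeilRank_layer_zero`-free remark: layer `0` is p07's theorem (0) above.
* §2 the rank-`0` ENDS of the four loci with `hbud ↦ (k) (hrk : LayerRankGEAt W p k b)`, each a
  one-liner over the owner's `…_of_budget` end consumed BY NAME (p10 X4♯(G-ord), p06 X3♯(G-ord), §3 p07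
  X4(M), p12 X3♯(M)); `p = 3` forms included (the N10/N11 rows).

HONEST YIELD NOTE (numbers, not adjectives). On an `r_an = 0` row a certificate `LayerRankGEAt W p k b`
with `b ≥ 1` asserts GENUINE RANK GROWTH `rank E(ℚ_k) ≥ b > 0 = rank E(ℚ)` in the cyclotomic tower,
i.e. `L(E, χ, 1) = 0` for a character `χ` of `Gal(ℚ_k/ℚ)` (order `p^j`, conductor `p^{j+1}`); by
Greenberg LNM 1716 §5 the `λ` forced by Tamagawa factors (`p ∣ c_ℓ`, the census budget `B(E,p)` of
ROUTE-2 II.9.2) is typically `λ^Ш`, NOT Mordell–Weil growth. So this arm is expected to discharge the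
budget only on rows whose branch series has a CYCLOTOMIC zero (`ξ_{p^k} ∣` the Néron-normalised branch
series — the rows iw-1's rank-growth census selects on X1/X2/X11b: RANK-GROWTH-L1.md, 109/124 layer-1
pairs certified there); on the 4 098 `B > rank` X3 rows of r2's universe the yield is UNMEASURED (census
ask, not run by this seat: `rank E(ℚ(ζ_9)⁺) ≥ B(E,3)` by 2-descent over the cubic field on rows with a
`ξ_9`-factor). The arm is recorded because it is the ONLY budget discharge in the tree with ZERO named-fact
binders, and because it makes the four `…_of_budget` chains consume iw-1's existing certificate format
unchanged.

References: R. Greenberg, LNM 1716 (1999) Thm. 1.9 (PDF p. 63), §5 (pp. 120–128: `λ^{M-W}`, `λ^Ш`)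
[GreenbergLNM1716]; ROUTE-2 II.9.2, II.15.2; HOME/b2b-bsdres-iw-1/oncall/rankgrowth/RANK-GROWTH-L1.md.
-/

set_option autoImplicit false

noncomputable section

open scoped Classical MatrixGroups ModularForm NumberField

open CongruenceSubgroup WeierstrassCurve NumberField Literature.NumberTheory.EllipticCurves
  Literature.NumberTheory.EllipticCurves.ModularForms
  Literature.NumberTheory.EllipticCurves.Rank1Residual
  Literature.NumberTheory.EllipticCurves.Rank1Residual.Typed
  Literature.NumberTheory.EllipticCurves.GreenbergVatsal2000
  Literature.NumberTheory.EllipticCurves.Delbourgo2002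
  Literature.NumberTheory.GaloisRepresentations
  Summit.BirchSwinnertonDyer.Rank1Residual.Iwasawa

namespace Summit.BirchSwinnertonDyer.Rank1Residual.Additive

variable {W : WeierstrassCurve ℚ} [W.IsElliptic] [W.IsGloballyMinimal] {p : ℕ} [hp : Fact p.Prime]

/-! ### §1 ARM ρ: the budget from a rank-growth certificate (Greenberg 1999 Thm. 1.9, a tree theorem) -/

/-- **ARM ρ — the Route-G budget from RANK GROWTH, binder-free.** A certificate
`Iwasawa.LayerRankGEAt W p k b` ("`b ≤ rank_ℤ E(ℚ_k)`", `ℚ_k` the `k`-th layer of the cyclotomic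
`ℤ_p`-extension) gives `BudgetLeLambdaAt p W b`: for every cyclotomic Pontryagin-dual datum `D` with
`X = D.X` finitely generated and torsion, `b ≤ rank E(ℚ_k) ≤ λ(X)` by Greenberg's Thm. 1.9, which is the
tree THEOREM `WeierstrassCurve.mordellWeilRank_layer_le_lambdaInvariant` (any `ℤ_p`-extension, any
reduction type; unit additive-p3). NO Prop. 4.14, NO `p ∤ #E(ℚ)_tors`, NO residual count, NO image or
reduction hypothesis; the budget's `μ = 0` binder is idle. Layer `0` is p07's
`AdditivePotMult.budgetLeLambdaAt_of_le_mordellWeilRank`. [cite: GreenbergLNM1716, Thm. 1.9 (PDF p. 63)] -/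
theorem budgetLeLambdaAt_of_layerRankGEAt {k b : ℕ} (hrk : Iwasawa.LayerRankGEAt W p k b) :
    BudgetLeLambdaAt p W b := by
  intro κ γ hκ hγ _ D _ hX _
  exact (hrk κ hκ).trans (W.mordellWeilRank_layer_le_lambdaInvariant hγ D hX k)

/-- ARM ρ, monotone form: `b ≤ m ≤ rank E(ℚ_k)` ⟹ `BudgetLeLambdaAt p W b`.
[cite: GreenbergLNM1716, Thm. 1.9 (PDF p. 63)] -/
theorem budgetLeLambdaAt_of_layerRankGEAt_of_le {k m b : ℕ} (hrk : Iwasawa.LayerRankGEAt W p k m)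
    (hb : b ≤ m) : BudgetLeLambdaAt p W b :=
  budgetLeLambdaAt_of_layerRankGEAt (hrk.mono W p hb)

omit [W.IsGloballyMinimal] in
/-- ARM ρ in the STRONGER, `μ`-free currency: a rank-growth certificate bounds `λ(X)` from below for
every finitely generated torsion cyclotomic dual datum, with no `μ = 0` hypothesis (the shape of
cc-typer-1's `LamAlgGEAt`-type inputs; stated unfolded so that any typed lower bound of this binder
prefix is discharged by `exact`). [cite: GreenbergLNM1716, Thm. 1.9 (PDF p. 63)] -/
theorem le_lambdaInvariant_of_layerRankGEAt {k b : ℕ} (hrk : Iwasawa.LayerRankGEAt W p k b)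
    {κ : ZpExtension ℚ p} {γ : Field.absoluteGaloisGroup ℚ} (hκ : κ.IsCyclotomic)
    (hγ : κ.IsTopGenerator γ) (D : W.SelmerDualData κ γ) [Module.Finite (IwasawaAlgebra p) D.X]
    (hX : D.IsTorsion) : b ≤ lambdaInvariant p D.X :=
  (hrk κ hκ).trans (W.mordellWeilRank_layer_le_lambdaInvariant hγ D hX k)

/-! ### §2 Rank-`0` ENDS with the budget supplied by a rank-growth certificate — X4♯(G-ord) (p10's ends
BY NAME) and X3♯(G-ord) (p06's ends BY NAME) -/

/-- **X4♯(G-ord) ∩ `I₀*` ∩ {`ρ̄` onto}, `p ≥ 5`, `r_an = 0`, non-CM, non-anomalous: `BSD(E,p)` ⟸ the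
named facts + ONE unit coefficient at index `b` + a RANK-GROWTH certificate `b ≤ rank E(ℚ_k)`** —
p10's `ClassX4Gord.bsdp_rankZero_of_katoHalf_of_coeffCert_of_budget_of_nonAnomalous` with
`hbud := budgetLeLambdaAt_of_layerRankGEAt hrk`. PER PAIR; EVIDENCE-tier certificate; X4♯ stays
CONSTRUCTION-SHAPED; nothing booked. [cite: GreenbergLNM1716, Thm. 1.9 (PDF p. 63)]
[cite: Kato2004Asterisque, Thm. 17.4 (3) (p. 273)] [cite: Delbourgo2002, Theorem (A), (B) (p. 40)]
[cite: Delbourgo1998, Prop. 4 (p. 144)] [cite: Miller2011LMS, §1 and Def. 1.1] -/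
theorem ClassX4Gord.bsdp_rankZero_of_katoHalf_of_coeffCert_of_layerRankGEAt_of_nonAnomalous
    (hK : Wuthrich2014.kato_halfEigenCharIdeal_dvd_cyclotomicPrime_of_surjective)
    (hPal : Pal2012.thm32_sqrt_mul_realPeriodRat_twist_eq_of_prime_one_mod_four)
    (hDel98 : Delbourgo1998.prop4_rankZero_pow_dvd_constantCoeff) (hDel : Delbourgo2002.mainTheorem)
    (hGZK : rank_eq_analyticRank_of_analyticRank_le_one) (hmod : hasEntireLFunction_rat)
    (hmodD : nonempty_modularParametrizationData)
    (hX : ClassX4Gord W p) (hcm : ¬ W.HasCM) (hp5 : 5 ≤ p) (he : semistabilityIndex W p = 2)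
    (hsurj : Surj W p) (hr : W.analyticRank = 0)
    {k b : ℕ} (hcert : BranchUnitCoeffAt W p b) (hrk : Iwasawa.LayerRankGEAt W p k b)
    (hna : ReductionNonAnomalous W p) : BSDp W p :=
  hX.bsdp_rankZero_of_katoHalf_of_coeffCert_of_budget_of_nonAnomalous hK hPal hDel98 hDel hGZK hmod hmodD
    hcm hp5 he hsurj hr hcert (budgetLeLambdaAt_of_layerRankGEAt hrk) hna

/-- **X4♯(G-ord) at `3` ∧ surj(3), `r_an = 0`, non-CM, non-anomalous (the N11 (G-ord) rows): `BSD(E,3)`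
⟸ the named facts + ONE 3-adic unit coefficient at index `b` + a RANK-GROWTH certificate
`b ≤ rank E(ℚ_k)` (`ℚ_1 = ℚ(ζ_9)⁺`), NO Pal binder** — p10's `…_of_budget_of_nonAnomalous_noPal` with
`hbud := budgetLeLambdaAt_of_layerRankGEAt hrk`. [cite: GreenbergLNM1716, Thm. 1.9 (PDF p. 63)]
[cite: Kato2004Asterisque, Thm. 17.4 (3) (p. 273)] [cite: Delbourgo2002, Theorem (A), (B) (p. 40), Hypothesis (p. 39)]
[cite: Delbourgo1998, Prop. 4 (p. 144)] [cite: Miller2011LMS, §1 and Def. 1.1] -/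
theorem ClassX4Gord.bsdp_three_rankZero_of_katoHalf_of_coeffCert_of_layerRankGEAt_of_nonAnomalous
    [Fact (Nat.Prime 3)] {W : WeierstrassCurve ℚ} [W.IsElliptic] [W.IsGloballyMinimal]
    (hK : Wuthrich2014.kato_halfEigenCharIdeal_dvd_cyclotomicPrime_of_surjective)
    (hDel98 : Delbourgo1998.prop4_rankZero_pow_dvd_constantCoeff)
    (hDel3 : Delbourgo2002.mainTheorem_three)
    (hGZK : rank_eq_analyticRank_of_analyticRank_le_one) (hmod : hasEntireLFunction_rat)
    (hmodD : nonempty_modularParametrizationData)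
    (hX : ClassX4Gord W 3) (hcm : ¬ W.HasCM) (hsurj : Surj W 3) (hr : W.analyticRank = 0)
    {k b : ℕ} (hcert : BranchUnitCoeffAt W 3 b) (hrk : Iwasawa.LayerRankGEAt W 3 k b)
    (hna : ReductionNonAnomalous W 3) : BSDp W 3 :=
  ClassX4Gord.bsdp_three_rankZero_of_katoHalf_of_coeffCert_of_budget_of_nonAnomalous_noPal hK hDel98
    hDel3 hGZK hmod hmodD hX hcm hsurj hr hcert (budgetLeLambdaAt_of_layerRankGEAt hrk) hna

/-- **X3♯(G-ord) ∩ `I₀*`, `p ≥ 5`, `r_an = 0`, non-CM, non-anomalous (REDUCIBLE `E[p]`): `BSD(E,p)` ⟸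
the named facts + ONE unit coefficient at index `b` + a RANK-GROWTH certificate `b ≤ rank E(ℚ_k)`** —
p06's `ClassX3Gord.bsdp_rankZero_of_wuthrichHalf_of_coeffCert_of_budget_of_nonAnomalous` with
`hbud := budgetLeLambdaAt_of_layerRankGEAt hrk`. On X3 this REPLACES the one unprinted input of the
schema route (`hres`, flag `X3-budget-unprinted`) by a certificate, at the price of the yield note in
the module docstring. [cite: GreenbergLNM1716, Thm. 1.9 (PDF p. 63)] [cite: Wuthrich2014, Thm. 16 (p. 397)]
[cite: Delbourgo2002, Theorem (A), (B) (p. 40)] [cite: Delbourgo1998, Prop. 4 (p. 144)]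
[cite: Pal2012, Thm. 3.2] [cite: Miller2011LMS, §1 and Def. 1.1] -/
theorem ClassX3Gord.bsdp_rankZero_of_wuthrichHalf_of_coeffCert_of_layerRankGEAt_of_nonAnomalous
    (hWu : Wuthrich2014.thm16_halfEigenCharIdeal_dvd_cyclotomicPrime)
    (hPal : Pal2012.thm32_sqrt_mul_realPeriodRat_twist_eq_of_prime_one_mod_four)
    (hDel98 : Delbourgo1998.prop4_rankZero_pow_dvd_constantCoeff) (hDel : Delbourgo2002.mainTheorem)
    (hGZK : rank_eq_analyticRank_of_analyticRank_le_one) (hmod : hasEntireLFunction_rat)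
    (hmodD : nonempty_modularParametrizationData)
    (hX : ClassX3Gord W p) (hcm : ¬ W.HasCM) (hp5 : 5 ≤ p) (he : semistabilityIndex W p = 2)
    (hr : W.analyticRank = 0)
    {k b : ℕ} (hcert : BranchUnitCoeffAt W p b) (hrk : Iwasawa.LayerRankGEAt W p k b)
    (hna : ReductionNonAnomalous W p) : BSDp W p :=
  hX.bsdp_rankZero_of_wuthrichHalf_of_coeffCert_of_budget_of_nonAnomalous hWu hPal hDel98 hDel hGZK hmod
    hmodD hcm hp5 he hr hcert (budgetLeLambdaAt_of_layerRankGEAt hrk) hna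

/-- **X3♯(G-ord) at `3`, `r_an = 0`, non-CM, non-anomalous (the N10 X3♯(G-ord) rows at `3`): `BSD(E,3)`
⟸ the named facts + ONE 3-adic unit coefficient at index `b` + a RANK-GROWTH certificate
`b ≤ rank E(ℚ_k)`; NO image hypothesis, NO tower, NO Pal** — p06's
`ClassX3Gord.bsdp_three_rankZero_of_wuthrichHalf_of_coeffCert_of_budget_of_nonAnomalous` with
`hbud := budgetLeLambdaAt_of_layerRankGEAt hrk`. [cite: GreenbergLNM1716, Thm. 1.9 (PDF p. 63)]
[cite: Wuthrich2014, Thm. 16 (p. 397)] [cite: Delbourgo2002, Theorem (A), (B) (p. 40), Hypothesis (p. 39)]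
[cite: Delbourgo1998, Prop. 4 (p. 144)] [cite: Miller2011LMS, §1 and Def. 1.1] -/
theorem ClassX3Gord.bsdp_three_rankZero_of_wuthrichHalf_of_coeffCert_of_layerRankGEAt_of_nonAnomalous
    [Fact (Nat.Prime 3)] {W : WeierstrassCurve ℚ} [W.IsElliptic] [W.IsGloballyMinimal]
    (hWu : Wuthrich2014.thm16_halfEigenCharIdeal_dvd_cyclotomicPrime)
    (hDel98 : Delbourgo1998.prop4_rankZero_pow_dvd_constantCoeff)
    (hDel3 : Delbourgo2002.mainTheorem_three)
    (hGZK : rank_eq_analyticRank_of_analyticRank_le_one) (hmod : hasEntireLFunction_rat)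
    (hmodD : nonempty_modularParametrizationData)
    (hX : ClassX3Gord W 3) (hcm : ¬ W.HasCM) (hr : W.analyticRank = 0)
    {k b : ℕ} (hcert : BranchUnitCoeffAt W 3 b) (hrk : Iwasawa.LayerRankGEAt W 3 k b)
    (hna : ReductionNonAnomalous W 3) : BSDp W 3 :=
  ClassX3Gord.bsdp_three_rankZero_of_wuthrichHalf_of_coeffCert_of_budget_of_nonAnomalous hWu hDel98 hDel3
    hGZK hmod hmodD hX hcm hr hcert (budgetLeLambdaAt_of_layerRankGEAt hrk) hna

end Summit.BirchSwinnertonDyer.Rank1Residual.Additive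

/-! ### §3 Rank-`0` ENDS on the potentially multiplicative loci — X4(M) (p07's ends BY NAME) and
X3♯(M) (p12's ends BY NAME), record currency `Mult[Odd]FirstUnitIndexAt` -/

namespace Summit.BirchSwinnertonDyer.Rank1Residual.AdditivePotMult

open Summit.BirchSwinnertonDyer.Rank1Residual.Additive
  Summit.BirchSwinnertonDyer.Rank1Residual.Additive.CensusQ6

variable {W : WeierstrassCurve ℚ} [W.IsElliptic] [W.IsGloballyMinimal] {p : ℕ} [hp : Fact p.Prime]

/-- **X4(M) ∧ surj(p) ∧ `r_an = 0`, EVERY odd `p`: `BSD(E,p)` ⟸ the census record at index `b` + a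
RANK-GROWTH certificate `b ≤ rank E(ℚ_k)`** — p07's
`ClassX4M.bsdp_rankZero_of_surj_of_katoHalf_of_firstUnitIndex_of_budget` with
`hbud := budgetLeLambdaAt_of_layerRankGEAt hrk`. [cite: GreenbergLNM1716, Thm. 1.9 (PDF p. 63)]
[cite: Kato2004Asterisque, Thm. 17.4 (3) (p. 273)] [cite: Delbourgo1998, Prop. 4 (p. 144)]
[cite: Pal2012, Thm. 3.2] [cite: Miller2011LMS, §1 and Def. 1.1] -/
theorem ClassX4M.bsdp_rankZero_of_surj_of_katoHalf_of_firstUnitIndex_of_layerRankGEAt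
    (hK : Wuthrich2014.kato_halfEigenCharIdeal_dvd_cyclotomicPrime_of_surjective)
    (hDel : Delbourgo1998.prop4_rankZero_pow_dvd_constantCoeff)
    (hDelX : Delbourgo1998.prop4_rankZero_constantCoeff_eq_unit_mul_of_potMult)
    (hPal : Pal2012.thm32_sqrt_mul_realPeriodRat_twist_eq_of_prime_one_mod_four)
    (hGZK : rank_eq_analyticRank_of_analyticRank_le_one) (hmod : hasEntireLFunction_rat)
    (hmodD : nonempty_modularParametrizationData)
    (hX : ClassX4M W p) (hsurj : Surj W p) (hr : W.analyticRank = 0) {k b : ℕ}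
    (hrec : (p % 4 = 1 → MultFirstUnitIndexAt W p b) ∧ (p % 4 = 3 → MultOddFirstUnitIndexAt W p b))
    (hrk : Iwasawa.LayerRankGEAt W p k b) : BSDp W p :=
  hX.bsdp_rankZero_of_surj_of_katoHalf_of_firstUnitIndex_of_budget hK hDel hDelX hPal hGZK hmod hmodD
    hsurj hr hrec (budgetLeLambdaAt_of_layerRankGEAt hrk)

/-- **X4(M) ∧ surj(3) ∧ `r_an = 0` (the N11 (M) rows): `BSD(E,3)` ⟸ the odd record
`MultOddFirstUnitIndexAt W 3 b` + a RANK-GROWTH certificate `b ≤ rank E(ℚ_k)` (`ℚ_1 = ℚ(ζ_9)⁺`)** —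
p07's `p = 3` end with `hbud := budgetLeLambdaAt_of_layerRankGEAt hrk`.
[cite: GreenbergLNM1716, Thm. 1.9 (PDF p. 63)] [cite: Kato2004Asterisque, Thm. 17.4 (3) (p. 273)]
[cite: Delbourgo1998, Prop. 4 (p. 144)] [cite: Miller2011LMS, Def. 1.1] -/
theorem ClassX4M.bsdp_three_rankZero_of_surj_of_katoHalf_of_firstUnitIndex_of_layerRankGEAt
    [Fact (Nat.Prime 3)] {W : WeierstrassCurve ℚ} [W.IsElliptic] [W.IsGloballyMinimal]
    (hK : Wuthrich2014.kato_halfEigenCharIdeal_dvd_cyclotomicPrime_of_surjective)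
    (hDel : Delbourgo1998.prop4_rankZero_pow_dvd_constantCoeff)
    (hDelX : Delbourgo1998.prop4_rankZero_constantCoeff_eq_unit_mul_of_potMult)
    (hPal : Pal2012.thm32_sqrt_mul_realPeriodRat_twist_eq_of_prime_one_mod_four)
    (hGZK : rank_eq_analyticRank_of_analyticRank_le_one) (hmod : hasEntireLFunction_rat)
    (hmodD : nonempty_modularParametrizationData)
    (hX : ClassX4M W 3) (hsurj : Surj W 3) (hr : W.analyticRank = 0) {k b : ℕ}
    (hrec : MultOddFirstUnitIndexAt W 3 b) (hrk : Iwasawa.LayerRankGEAt W 3 k b) : BSDp W 3 :=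
  hX.bsdp_three_rankZero_of_surj_of_katoHalf_of_firstUnitIndex_of_budget hK hDel hDelX hPal hGZK hmod
    hmodD hsurj hr hrec (budgetLeLambdaAt_of_layerRankGEAt hrk)

/-- **X3♯(M) (REDUCIBLE `E[p]`) ∧ `r_an = 0`, EVERY odd `p`: `BSD(E,p)` ⟸ the census record at index
`b` + a RANK-GROWTH certificate `b ≤ rank E(ℚ_k)`** — p12's
`ClassX3M.bsdp_rankZero_of_wuthrichHalf_of_firstUnitIndex_of_budget` with
`hbud := budgetLeLambdaAt_of_layerRankGEAt hrk`. On X3♯(M) this REPLACES the one unprinted input `hres`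
(flag `X3-budget-unprinted`) AND the Prop. 4.14 record AND `p ∤ #E(ℚ)_tors` by a certificate; NO
image / tower / `5 ≤ p` / CM / anomalous binder. [cite: GreenbergLNM1716, Thm. 1.9 (PDF p. 63)]
[cite: Wuthrich2014, Thm. 16 (p. 397)] [cite: Delbourgo1998, Prop. 4 (p. 144)] [cite: Pal2012, Thm. 3.2]
[cite: Miller2011LMS, §1 and Def. 1.1] -/
theorem ClassX3M.bsdp_rankZero_of_wuthrichHalf_of_firstUnitIndex_of_layerRankGEAt
    (hW16 : Wuthrich2014.thm16_halfEigenCharIdeal_dvd_cyclotomicPrime)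
    (hDel : Delbourgo1998.prop4_rankZero_pow_dvd_constantCoeff)
    (hDelX : Delbourgo1998.prop4_rankZero_constantCoeff_eq_unit_mul_of_potMult)
    (hPal : Pal2012.thm32_sqrt_mul_realPeriodRat_twist_eq_of_prime_one_mod_four)
    (hGZK : rank_eq_analyticRank_of_analyticRank_le_one) (hmod : hasEntireLFunction_rat)
    (hmodD : nonempty_modularParametrizationData)
    (hX : ClassX3M W p) (hr : W.analyticRank = 0) {k b : ℕ}
    (hrec : (p % 4 = 1 → MultFirstUnitIndexAt W p b) ∧ (p % 4 = 3 → MultOddFirstUnitIndexAt W p b))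
    (hrk : Iwasawa.LayerRankGEAt W p k b) : BSDp W p :=
  hX.bsdp_rankZero_of_wuthrichHalf_of_firstUnitIndex_of_budget hW16 hDel hDelX hPal hGZK hmod hmodD hr
    hrec (budgetLeLambdaAt_of_layerRankGEAt hrk)

/-- **Pal-free odd form: X3♯(M) ∧ `r_an = 0`, `p ≡ 3 (mod 4)`: `BSD(E,p)` ⟸ the odd record + a
RANK-GROWTH certificate** — p12's `…_of_budget_odd` with `hbud := budgetLeLambdaAt_of_layerRankGEAt hrk`.
[cite: GreenbergLNM1716, Thm. 1.9 (PDF p. 63)] [cite: Wuthrich2014, Thm. 16 (p. 397)]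
[cite: Delbourgo1998, Prop. 4 (p. 144) and §2.2 Lemma (ii) (p. 139)] [cite: Miller2011LMS, Def. 1.1] -/
theorem ClassX3M.bsdp_rankZero_of_wuthrichHalf_of_firstUnitIndex_of_layerRankGEAt_odd
    (hW16 : Wuthrich2014.thm16_halfEigenCharIdeal_dvd_cyclotomicPrime)
    (hDel : Delbourgo1998.prop4_rankZero_pow_dvd_constantCoeff)
    (hDelX : Delbourgo1998.prop4_rankZero_constantCoeff_eq_unit_mul_of_potMult)
    (hGZK : rank_eq_analyticRank_of_analyticRank_le_one) (hmod : hasEntireLFunction_rat)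
    (hmodD : nonempty_modularParametrizationData)
    (hX : ClassX3M W p) (hp4 : p % 4 = 3) (hr : W.analyticRank = 0) {k b : ℕ}
    (hrec : MultOddFirstUnitIndexAt W p b) (hrk : Iwasawa.LayerRankGEAt W p k b) : BSDp W p :=
  hX.bsdp_rankZero_of_wuthrichHalf_of_firstUnitIndex_of_budget_odd hW16 hDel hDelX hGZK hmod hmodD hp4 hr
    hrec (budgetLeLambdaAt_of_layerRankGEAt hrk)

/-- **X3♯(M) at `3` ∧ `r_an = 0` (the N10 X3♯(M) rows at `3`): `BSD(E,3)` ⟸ the odd record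
`MultOddFirstUnitIndexAt W 3 b` + a RANK-GROWTH certificate `b ≤ rank E(ℚ_k)` (`ℚ_1 = ℚ(ζ_9)⁺`); NO
Pal, NO image hypothesis** — p12's `p = 3` end with `hbud := budgetLeLambdaAt_of_layerRankGEAt hrk`.
[cite: GreenbergLNM1716, Thm. 1.9 (PDF p. 63)] [cite: Wuthrich2014, Thm. 16 (p. 397)]
[cite: Delbourgo1998, Prop. 4 (p. 144)] [cite: Miller2011LMS, Def. 1.1] -/
theorem ClassX3M.bsdp_three_rankZero_of_wuthrichHalf_of_firstUnitIndex_of_layerRankGEAt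
    [Fact (Nat.Prime 3)] {W : WeierstrassCurve ℚ} [W.IsElliptic] [W.IsGloballyMinimal]
    (hW16 : Wuthrich2014.thm16_halfEigenCharIdeal_dvd_cyclotomicPrime)
    (hDel : Delbourgo1998.prop4_rankZero_pow_dvd_constantCoeff)
    (hDelX : Delbourgo1998.prop4_rankZero_constantCoeff_eq_unit_mul_of_potMult)
    (hGZK : rank_eq_analyticRank_of_analyticRank_le_one) (hmod : hasEntireLFunction_rat)
    (hmodD : nonempty_modularParametrizationData)
    (hX : ClassX3M W 3) (hr : W.analyticRank = 0) {k b : ℕ}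
    (hrec : MultOddFirstUnitIndexAt W 3 b) (hrk : Iwasawa.LayerRankGEAt W 3 k b) : BSDp W 3 :=
  hX.bsdp_three_rankZero_of_wuthrichHalf_of_firstUnitIndex_of_budget hW16 hDel hDelX hGZK hmod hmodD hr
    hrec (budgetLeLambdaAt_of_layerRankGEAt hrk)

end Summit.BirchSwinnertonDyer.Rank1Residual.AdditivePotMult

end
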